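import Literature.MathematicalPhysics.QuantumManyBody.JelliumLemma53
import HarnessLib

/-!
# Lieb–Solovej Lemma 5.2 (control of the terms with `ŵ_{00,00}`) in first quantization

Topic `Literature/MathematicalPhysics/QuantumManyBody` (the charged Bose gas, `JelliumBoseGas.foldyLaw`).
[LiebSolovej2001, Lemma 5.2]: the terms of `H^n_{ℓ,r,R}` containing `ŵ_{00,00}` are
`½ŵ_{00,00}(a*₀a*₀a₀a₀ - 2ρℓ³a*₀a₀ + ρ²ℓ⁶) = ½ŵ_{00,00}[(n̂₀ - ρℓ³)² - n̂₀]`.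

First quantization (projections `Pⱼ` of `JelliumSliceProjections.lean`, pair weight
`w(x,y) = θ(x)V(x-y)θ(y) ≥ 0`, `m(x) = ∫_Λ w(x,y)dy`, `ŵ_{00,00} = ℓ⁻⁶∬_{Λ²}w`): the three pieces are
the pair block `½∑_{i≠j}⟨PᵢPⱼΨ, w(xᵢ,xⱼ)PᵢPⱼΨ⟩`, the background block `-ρ∑ⱼ⟨PⱼΨ, m(xⱼ)PⱼΨ⟩` and the
constant `½ρ²∬w`. Since `PᵢPⱼΨ` does not depend on `xᵢ, xⱼ`, the weights integrate out ("dummy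
integrations"):

* `lintegral_cellN_weight_of_update_invariant` — `∫_{Λⁿ} g(X,xⱼ)|F|² = ℓ⁻³∫_{Λⁿ}(∫_Λ g(X,y)dy)|F|²`
  for `F` independent of `xⱼ`;
* `pairPP_eq` — `∫_{Λⁿ} w(xᵢ,xⱼ)|PᵢPⱼΨ|² = ℓ⁻⁶(∬w)‖PᵢPⱼΨ‖²` (`i ≠ j`);
* `bgP_eq` — `∫_{Λⁿ} m(xⱼ)|PⱼΨ|² = ℓ⁻³(∬w)‖PⱼΨ‖²`;
* `ls_lemma52` — **Lemma 5.2** (first equality):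
  `½∑_{i≠j}∫w(xᵢ,xⱼ)|PᵢPⱼΨ|² - ρ∑ⱼ∫m(xⱼ)|PⱼΨ|² + ½ρ²(∬w)‖Ψ‖²
     = ½ŵ_{00,00}[∑_{i≠j}‖PᵢPⱼΨ‖² - 2ρℓ³∑ⱼ‖PⱼΨ‖² + ρ²ℓ⁶‖Ψ‖²]`,
  i.e. `½ŵ_{00,00}⟨(n̂₀ - ρℓ³)² - n̂₀⟩` with `⟨n̂₀⟩ = ∑ⱼ‖PⱼΨ‖²`, `⟨n̂₀(n̂₀-1)⟩ = ∑_{i≠j}‖PᵢPⱼΨ‖²`.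

## References

* [LiebSolovej2001] E. H. Lieb, J. P. Solovej, Commun. Math. Phys. 217 (2001) 127–163, Lemma 5.2
  (arXiv:cond-mat/0007425, p. 11).
-/

noncomputable section

open MeasureTheory Set Filter Real
open scoped ENNReal NNReal Topology

namespace Literature.MathematicalPhysics.QuantumManyBody.JelliumBoseGas

open BoseGas

variable {n : ℕ} {ℓ : ℝ}

/-! ### Dummy integrations -/

/-- **Integrating out a variable on which `F` does not depend**: for `F` independent of `xⱼ`
and a jointly measurable weight `g(X, y)` independent of `xⱼ` in its first argument,
`∫_{Λⁿ} g(X, xⱼ)|F(X)|² dX = ℓ⁻³ ∫_{Λⁿ} (∫_Λ g(X,y)dy)|F(X)|² dX`. [cite: LiebSolovej2001, Lemma 5.2 (proof)] -/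
theorem lintegral_cellN_weight_of_update_invariant (hℓ : 0 < ℓ) (j : Fin n)
    {g : Config n → Space → ℝ≥0∞} (hg : Measurable (Function.uncurry g))
    (hgj : ∀ X y z, g (Function.update X j z) y = g X y)
    {F : Config n → ℂ} (hFm : Measurable F) (hFj : ∀ X z, F (Function.update X j z) = F X) :
    ∫⁻ X in cellN n ℓ, g X (X j) * (‖F X‖₊ : ℝ≥0∞) ^ 2 =
      (ENNReal.ofReal ℓ ^ 3)⁻¹ * ∫⁻ X in cellN n ℓ, (∫⁻ y in cell ℓ, g X y) * (‖F X‖₊ : ℝ≥0∞) ^ 2 := by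
  have hL3 : ENNReal.ofReal ℓ ^ 3 ≠ 0 := pow_ne_zero _ (by simpa using hℓ)
  have hL3' : ENNReal.ofReal ℓ ^ 3 ≠ ⊤ := ENNReal.pow_ne_top ENNReal.ofReal_ne_top
  have hH : Measurable fun X : Config n => g X (X j) * (‖F X‖₊ : ℝ≥0∞) ^ 2 :=
    (hg.comp (measurable_id.prodMk (measurable_pi_apply j))).mul
      (hFm.nnnorm.coe_nnreal_ennreal.pow_const _)
  have e := lintegral_cellN_lintegral_update j hH (L := ℓ)
  have hfib : ∀ X : Config n, ∫⁻ y in cell ℓ, g (Function.update X j y) ((Function.update X j y) j) *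
      (‖F (Function.update X j y)‖₊ : ℝ≥0∞) ^ 2 = (∫⁻ y in cell ℓ, g X y) * (‖F X‖₊ : ℝ≥0∞) ^ 2 := by
    intro X
    simp_rw [Function.update_self, hgj, hFj]
    have hmy : Measurable fun y : Space => g X y := hg.comp (measurable_const.prodMk measurable_id)
    rw [lintegral_mul_const _ hmy]
  simp_rw [hfib] at e
  rw [e, ← mul_assoc, ENNReal.inv_mul_cancel hL3 hL3', one_mul]

/-- `Pᵢ(PⱼΨ)` is independent of `xⱼ` (as well as of `xᵢ`), for continuous `Ψ`
(`PᵢPⱼ = PⱼPᵢ`). [folklore] -/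
theorem sliceMean_sliceMean_update (ℓ : ℝ) (i j : Fin n) {Ψ : Config n → ℂ} (hΨ : Continuous Ψ)
    (X : Config n) (z : Space) :
    sliceMean ℓ i (sliceMean ℓ j Ψ) (Function.update X j z) = sliceMean ℓ i (sliceMean ℓ j Ψ) X := by
  rw [sliceMean_comm ℓ i j hΨ, sliceMean_update, sliceMean_comm ℓ j i hΨ]

/-! ### The two blocks -/

section Blocks

variable {w : Space → Space → ℝ≥0∞}

/-- **The pair block**: for `i ≠ j`, a jointly measurable pair weight `w ≥ 0` and continuous `Ψ`,
`∫_{Λⁿ} w(xᵢ,xⱼ)|PᵢPⱼΨ|² = ℓ⁻⁶(∬_{Λ²}w)‖PᵢPⱼΨ‖²` (`⟨a*₀a*₀a₀a₀⟩`-terms).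
[cite: LiebSolovej2001, Lemma 5.2 (proof)] -/
theorem pairPP_eq (hℓ : 0 < ℓ) {i j : Fin n} (hij : i ≠ j) (hw : Measurable (Function.uncurry w))
    {Ψ : Config n → ℂ} (hΨ : Continuous Ψ) :
    ∫⁻ X in cellN n ℓ, w (X i) (X j) * (‖sliceMean ℓ i (sliceMean ℓ j Ψ) X‖₊ : ℝ≥0∞) ^ 2 =
      (ENNReal.ofReal ℓ ^ 3)⁻¹ * (ENNReal.ofReal ℓ ^ 3)⁻¹ * (∫⁻ x in cell ℓ, ∫⁻ y in cell ℓ, w x y) *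
        ∫⁻ X in cellN n ℓ, (‖sliceMean ℓ i (sliceMean ℓ j Ψ) X‖₊ : ℝ≥0∞) ^ 2 := by
  set G : Config n → ℂ := sliceMean ℓ i (sliceMean ℓ j Ψ) with hG
  have hGc : Continuous G := continuous_sliceMean ℓ i (continuous_sliceMean ℓ j hΨ)
  have hGj : ∀ X z, G (Function.update X j z) = G X := fun X z => sliceMean_sliceMean_update ℓ i j hΨ X z
  have hGi : ∀ X z, G (Function.update X i z) = G X := fun X z => sliceMean_update ℓ i _ X z
  -- integrate out `xⱼ`
  have hg1 : Measurable (Function.uncurry fun (X : Config n) (y : Space) => w (X i) y) := by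
    have e : (Function.uncurry fun (X : Config n) (y : Space) => w (X i) y) =
        Function.uncurry w ∘ fun p : Config n × Space => (p.1 i, p.2) := rfl
    rw [e]
    exact hw.comp (by fun_prop)
  have h1 := lintegral_cellN_weight_of_update_invariant hℓ j (g := fun X y => w (X i) y) hg1
    (fun X y z => by simp only [Function.update_of_ne hij]) hGc.measurable hGj
  -- integrate out `xᵢ`
  have hmw : Measurable fun x : Space => ∫⁻ y in cell ℓ, w x y := hw.lintegral_prod_right'
  have hg2 : Measurable (Function.uncurry fun (_ : Config n) (y : Space) => ∫⁻ y' in cell ℓ, w y y') :=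
    hmw.comp measurable_snd
  have h2 := lintegral_cellN_weight_of_update_invariant hℓ i
    (g := fun _ y => ∫⁻ y' in cell ℓ, w y y') hg2 (fun X y z => rfl) hGc.measurable hGi
  rw [h1, h2, lintegral_const_mul _ (hGc.measurable.nnnorm.coe_nnreal_ennreal.pow_const _)]
  ring

/-- **The background block**: for a jointly measurable pair weight `w ≥ 0` and continuous `Ψ`,
with `m(x) = ∫_Λ w(x,y)dy`: `∫_{Λⁿ} m(xⱼ)|PⱼΨ|² = ℓ⁻³(∬_{Λ²}w)‖PⱼΨ‖²` (`⟨a*₀a₀⟩`-terms).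
[cite: LiebSolovej2001, Lemma 5.2 (proof)] -/
theorem bgP_eq (hℓ : 0 < ℓ) (j : Fin n) (hw : Measurable (Function.uncurry w))
    {Ψ : Config n → ℂ} (hΨ : Continuous Ψ) :
    ∫⁻ X in cellN n ℓ, (∫⁻ y in cell ℓ, w (X j) y) * (‖sliceMean ℓ j Ψ X‖₊ : ℝ≥0∞) ^ 2 =
      (ENNReal.ofReal ℓ ^ 3)⁻¹ * (∫⁻ x in cell ℓ, ∫⁻ y in cell ℓ, w x y) *
        ∫⁻ X in cellN n ℓ, (‖sliceMean ℓ j Ψ X‖₊ : ℝ≥0∞) ^ 2 := by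
  have hGc : Continuous (sliceMean ℓ j Ψ) := continuous_sliceMean ℓ j hΨ
  have hmw : Measurable fun x : Space => ∫⁻ y in cell ℓ, w x y := hw.lintegral_prod_right'
  have hg2 : Measurable (Function.uncurry fun (_ : Config n) (y : Space) => ∫⁻ y' in cell ℓ, w y y') :=
    hmw.comp measurable_snd
  have h := lintegral_cellN_weight_of_update_invariant hℓ j
    (g := fun _ y => ∫⁻ y' in cell ℓ, w y y') hg2 (fun X y z => rfl) hGc.measurable
    (fun X z => sliceMean_update ℓ j Ψ X z)
  rw [h, lintegral_const_mul _ (hGc.measurable.nnnorm.coe_nnreal_ennreal.pow_const _), mul_assoc]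

end Blocks

/-! ### Lemma 5.2 -/

/-- **[LiebSolovej2001, Lemma 5.2] (control of the terms with `ŵ_{00,00}`), first-quantized
expectation form (first equality).** For `ℓ > 0`, a jointly measurable pair weight `w ≥ 0`,
`ρ ∈ ℝ`, a continuous `n`-body function `Ψ` and any real `‖Ψ‖²` (the constant term's factor):
writing `c = ∬_{Λ²} w`, `ŵ₀ = ℓ⁻⁶c` (`= ŵ_{00,00}`), `N₀ = ∑ⱼ‖PⱼΨ‖²` (`= ⟨n̂₀⟩`) and
`N₀₀ = ∑_{i≠j}‖PᵢPⱼΨ‖²` (`= ⟨n̂₀(n̂₀-1)⟩ = ⟨a*₀a*₀a₀a₀⟩`),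
`½∑_{i≠j}∫w(xᵢ,xⱼ)|PᵢPⱼΨ|² - ρ∑ⱼ∫m(xⱼ)|PⱼΨ|² + ½ρ²c‖Ψ‖² = ½ŵ₀(N₀₀ - 2ρℓ³N₀ + ρ²ℓ⁶‖Ψ‖²)`
(`= ½ŵ_{00,00}⟨(n̂₀-ρℓ³)² - n̂₀⟩`). [cite: LiebSolovej2001, Lemma 5.2] -/
theorem ls_lemma52 (hℓ : 0 < ℓ) {w : Space → Space → ℝ≥0∞} (hw : Measurable (Function.uncurry w))
    {Ψ : Config n → ℂ} (hΨ : Continuous Ψ) (ρ : ℝ) (normSq : ℝ) :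
    1 / 2 * (∑ i : Fin n, ∑ j ∈ Finset.univ.erase i,
        (∫⁻ X in cellN n ℓ, w (X i) (X j) * (‖sliceMean ℓ i (sliceMean ℓ j Ψ) X‖₊ : ℝ≥0∞) ^ 2).toReal) -
      ρ * (∑ j : Fin n, (∫⁻ X in cellN n ℓ, (∫⁻ y in cell ℓ, w (X j) y) *
        (‖sliceMean ℓ j Ψ X‖₊ : ℝ≥0∞) ^ 2).toReal) +
      1 / 2 * ρ ^ 2 * (∫⁻ x in cell ℓ, ∫⁻ y in cell ℓ, w x y).toReal * normSq =
    1 / 2 * ((ℓ ^ 3)⁻¹ * (ℓ ^ 3)⁻¹ * (∫⁻ x in cell ℓ, ∫⁻ y in cell ℓ, w x y).toReal) *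
      ((∑ i : Fin n, ∑ j ∈ Finset.univ.erase i,
          (∫⁻ X in cellN n ℓ, (‖sliceMean ℓ i (sliceMean ℓ j Ψ) X‖₊ : ℝ≥0∞) ^ 2).toReal) -
        2 * ρ * ℓ ^ 3 * (∑ j : Fin n, (∫⁻ X in cellN n ℓ, (‖sliceMean ℓ j Ψ X‖₊ : ℝ≥0∞) ^ 2).toReal) +
        ρ ^ 2 * (ℓ ^ 3) ^ 2 * normSq) := by
  have hℓ3 : (0 : ℝ) < ℓ ^ 3 := by positivity
  have hinv : ((ENNReal.ofReal ℓ ^ 3)⁻¹).toReal = (ℓ ^ 3)⁻¹ := by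
    rw [ENNReal.toReal_inv, ENNReal.toReal_pow, ENNReal.toReal_ofReal hℓ.le]
  -- rewrite each block
  have hPP : ∀ i : Fin n, ∀ j ∈ Finset.univ.erase i,
      (∫⁻ X in cellN n ℓ, w (X i) (X j) * (‖sliceMean ℓ i (sliceMean ℓ j Ψ) X‖₊ : ℝ≥0∞) ^ 2).toReal =
        (ℓ ^ 3)⁻¹ * (ℓ ^ 3)⁻¹ * (∫⁻ x in cell ℓ, ∫⁻ y in cell ℓ, w x y).toReal *
          (∫⁻ X in cellN n ℓ, (‖sliceMean ℓ i (sliceMean ℓ j Ψ) X‖₊ : ℝ≥0∞) ^ 2).toReal := by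
    intro i j hj
    have hij : i ≠ j := (Finset.ne_of_mem_erase hj).symm
    rw [pairPP_eq hℓ hij hw hΨ, ENNReal.toReal_mul, ENNReal.toReal_mul, ENNReal.toReal_mul, hinv]
  have hP : ∀ j : Fin n,
      (∫⁻ X in cellN n ℓ, (∫⁻ y in cell ℓ, w (X j) y) * (‖sliceMean ℓ j Ψ X‖₊ : ℝ≥0∞) ^ 2).toReal =
        (ℓ ^ 3)⁻¹ * (∫⁻ x in cell ℓ, ∫⁻ y in cell ℓ, w x y).toReal *
          (∫⁻ X in cellN n ℓ, (‖sliceMean ℓ j Ψ X‖₊ : ℝ≥0∞) ^ 2).toReal := by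
    intro j
    rw [bgP_eq hℓ j hw hΨ, ENNReal.toReal_mul, ENNReal.toReal_mul, hinv]
  rw [Finset.sum_congr rfl fun i _ => Finset.sum_congr rfl (hPP i), Finset.sum_congr rfl fun j _ => hP j]
  simp_rw [← Finset.mul_sum]
  field_simp

end Literature.MathematicalPhysics.QuantumManyBody.JelliumBoseGas
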